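import Summits.BirchSwinnertonDyer.BirchSwinnertonDyer.Theorems.BiquadraticEisensteinDescentHeegnerTwistCouplingInSupplySymbolicMonskyTwoPrimeCore
import Summits.BirchSwinnertonDyer.BirchSwinnertonDyer.Theorems.BiquadraticEisensteinDescentHeegnerTwistCouplingInSupplySymbolicMonskyClosureSemantic
import HarnessLib

set_option linter.dupNamespace false -- `Summit.BirchSwinnertonDyer.BirchSwinnertonDyer.Theorems.…` (summit = sub)
set_option autoImplicit false

/-!
# Crux `HeegnerTwistCouplingInSupply` (stmt-BirchSwinnertonDyer-21381) — the TWO-PRIME RECIPE, part 3: ★★ every base with `s* = 2` owns a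
# PATTERN-FREE Heegner recipe with exactly two auxiliary primes (all `k`)

Route `BiquadraticEisensteinDescent` (cell `pub/bsd-wall`, width seat `bsd-wall-cm-bed-w3` g21; `--supports` 21381, helper). File (3/3); the first
ALL-`k` EXISTENCE theorem of the corner layer (everything before: per-instance `decide`, or necessary conditions).

★★ `det_dataK_twoPrime_eq_one` / `twoPrime_recipe`. Let `base : SymbData (k+1)` be any base datum whose virtual kernel is a line: a virtual kernel
pair `(u¹, w¹)` (`(L + D_m)u¹ + D_d w¹ = 0`, `D_m u¹ + L w¹ = 0`, written out in the base's completed symbols and classes) such that every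
virtual kernel pair is `0` or `(u¹, w¹)` — equivalently `s* = 2`, `t₀ = 2` (memo PATTERN-FREE-MECHANISM-w3g20 §3; 73 % of all configurations at
`k = 5`, the generic case). Take two auxiliary cells: `c₂ ≡ 1 (mod 4)` with symbol bits `σ` of ODD weight, `c₁ ≡ 3 (mod 4)` with bits `m + σ`
(so the Heegner parities hold: `heegnerK_twoPrime`) and the same `(2/·)`-class `ε̂` as `c₂`, with `ε̂·⟨σ, w¹⟩ + ⟨σ, u¹⟩ = 1` — e.g. `σ = e_(b₀)`
for a base index `b₀` with `u¹_(b₀) = 1` (any `ε̂`) or with `u¹ = 0`, `w¹_(b₀) = 1` (`ε̂ = 1`, classes `3` and `5`). THEN Monsky's odd matrix of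
`(base, [c₁, c₂], pat)` has `det = 1` for EVERY mutual pattern `pat`: the recipe is pattern-free, with `t = 2 = t₀` auxiliary primes
(optimal by `…AuxLowerBoundSelmer`). In words: for every such `n₀ = P₀⋯P_k`, every pair of primes `q₁ ≡ 3 (4)`, `q₂ ≡ 1 (4)` in these two
cells makes `Sel₂(E_(n₀ q₁ q₂))` minimal WHATEVER `(q₂/q₁)` is — so the general-`k` doors / censuses apply with two independent slots.
Proof: the semantic closure criterion `SymbData.det_monskyOddS_eq_one_of_staged_constancy` (order `w`, `u`) with the stages discharged by
`twoPrime_core` and `twoPrime_S3`. Explicit cells from ONE base index in the support of the kernel pair: `twoPrime_recipe_of_index`;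
★★ `exists_twoPrime_recipe`: if the virtual kernel is the line of a non-zero pair, two cells with `heegnerK ∧ ∀ pat, det = 1` EXIST.

HONEST FRAMING: RUNG-LEVEL corner layer (congruent `j = 1728` families); an existence theorem about Monsky matrices, not an instance of the crux by
itself (instances still need located primes: the doors of `…PatternFreeDoor` / `…ClosureSymb` and the Linnik censuses); the crux as stated (C⁺),
its registered stubs and BSD are NOT touched; nothing is closed. THEOREMS ONLY.
Reference: [HeathBrown1994] appendix (Monsky), typescript pp. 39–41.
-/

namespace Summit.BirchSwinnertonDyer.BirchSwinnertonDyer.Theorems.SymbolicMonsky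

section TwoPrimeMain

open Matrix

variable {k : ℕ} (base : SymbData (k + 1)) (c₁ c₂ : AuxCell)

/-- ★★ **THE TWO-PRIME RECIPE (every `k`; the `s* = 2` theorem of memo PATTERN-FREE-STRUCTURE-w3g21 §5b).** Let `(u¹, w¹)` be a virtual
kernel pair of the base spanning the virtual kernel (`hker`: every virtual kernel pair is `0` or `(u¹, w¹)` — i.e. `s* = 2`). Take two
auxiliary cells: `c₂ ≡ 1 (mod 4)` with symbol vector `σ` of ODD weight, `c₁ ≡ 3 (mod 4)` with symbol vector `m + σ` and the same
`(2/·)`-class `ε̂`, such that `ε̂·⟨σ, w¹⟩ + ⟨σ, u¹⟩ = 1` (always possible: `σ = e_{b₀}` with `b₀` in the support of `u¹`, any `ε̂`; or of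
`w¹` with `ε̂ = 1`). Then Monsky's odd matrix of `(base, [c₁, c₂], pat)` is invertible for EVERY mutual pattern `pat` — the recipe is
pattern-free with `t = 2 = t₀` auxiliary primes. Proof: the semantic closure criterion (`…ClosureSemantic`) in the order (w, u), with the
stages discharged by `twoPrime_core` (left-kernel pairing) and `twoPrime_S3`.
[cite: HeathBrown1994SelmerCongruentII, Appendix (Monsky), typescript p. 39 L27–L33] -/
theorem det_dataK_twoPrime_eq_one (hm1 : negNegOne c₁.1 = true) (hm2 : negNegOne c₂.1 = false) (hd : negTwo c₁.1 = negTwo c₂.1)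
    (hσ : ∀ b : Fin (k + 1), c₁.2.testBit b.val = xor (negNegOne (base.cls b)) (c₂.2.testBit b.val))
    (hodd : (∑ b : Fin (k + 1), bz (c₂.2.testBit b.val)) = 1)
    (u1 w1 : Fin (k + 1) → ZMod 2)
    (hE1 : ∀ i, (∑ j, bz (base.neg i j) * (u1 j + u1 i)) + bz (negNegOne (base.cls i)) * u1 i + bz (negTwo (base.cls i)) * w1 i = 0)
    (hE2 : ∀ i, bz (negNegOne (base.cls i)) * u1 i + ∑ j, bz (base.neg i j) * (w1 j + w1 i) = 0)
    (hker : ∀ x y : Fin (k + 1) → ZMod 2,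
      (∀ i, (∑ j, bz (base.neg i j) * (x j + x i)) + bz (negNegOne (base.cls i)) * x i + bz (negTwo (base.cls i)) * y i = 0) →
      (∀ i, bz (negNegOne (base.cls i)) * x i + ∑ j, bz (base.neg i j) * (y j + y i) = 0) →
      (x = 0 ∧ y = 0) ∨ (x = u1 ∧ y = w1))
    (hdes : bz (negTwo c₂.1) * (∑ b : Fin (k + 1), bz (c₂.2.testBit b.val) * w1 b) +
      (∑ b : Fin (k + 1), bz (c₂.2.testBit b.val) * u1 b) = 1)
    (pat : ℕ → ℕ → Bool) :
    (dataK base [c₁, c₂] pat).monskyOddS.det = 1 := by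
  classical
  have h20 : ((2 : ℕ) = 0) = False := by simp
  have h21 : ((2 : ℕ) = 1) = False := by simp
  -- unpack «Q i = true» into an auxiliary index
  have auxIdx : ∀ i : Fin (k + 1 + [c₁, c₂].length), auxQ k [c₁, c₂].length i = true →
      ∃ j : Fin [c₁, c₂].length, i = Fin.natAdd (k + 1) j := by
    intro i hi
    induction i using Fin.addCases with
    | left b => rw [auxQ_castAdd] at hi; exact absurd hi (by simp)
    | right j => exact ⟨j, rfl⟩
  -- from the pattern-independent data of a vector `z`, the core identities
  have CORE : ∀ z : Fin (k + 1 + [c₁, c₂].length) ⊕ Fin (k + 1 + [c₁, c₂].length) → ZMod 2,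
      (∀ i, auxQ k [c₁, c₂].length i = false →
        ((dataK base [c₁, c₂] (fun _ _ => false)).monskyOddS *ᵥ z) (Sum.inl i) = 0 ∧
        ((dataK base [c₁, c₂] (fun _ _ => false)).monskyOddS *ᵥ z) (Sum.inr i) = 0) →
      (∑ i ∈ Finset.univ.filter (fun i => auxQ k [c₁, c₂].length i = true),
        ((dataK base [c₁, c₂] (fun _ _ => false)).monskyOddS *ᵥ z) (Sum.inl i)) = 0 →
      (∑ i ∈ Finset.univ.filter (fun i => auxQ k [c₁, c₂].length i = true),
        ((dataK base [c₁, c₂] (fun _ _ => false)).monskyOddS *ᵥ z) (Sum.inr i)) = 0 →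
      (z (Sum.inl (Fin.natAdd (k + 1) (⟨0, by simp⟩ : Fin [c₁, c₂].length))) + z (Sum.inr (Fin.natAdd (k + 1) (⟨0, by simp⟩ : Fin [c₁, c₂].length)))) +
        (z (Sum.inl (Fin.natAdd (k + 1) (⟨1, by simp⟩ : Fin [c₁, c₂].length))) + z (Sum.inr (Fin.natAdd (k + 1) (⟨1, by simp⟩ : Fin [c₁, c₂].length)))) = 0 ∧
      z (Sum.inl (Fin.natAdd (k + 1) (⟨0, by simp⟩ : Fin [c₁, c₂].length))) = z (Sum.inl (Fin.natAdd (k + 1) (⟨1, by simp⟩ : Fin [c₁, c₂].length))) := by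
    intro z hout hs1 hs2
    rw [sum_filter_auxQ] at hs1 hs2
    have c := twoPrime_core base c₁ c₂ hm1 hm2 hd hσ hodd u1 w1 hE1 hE2 hdes z
      (fun b => (hout _ (auxQ_castAdd _ b)).1) (fun b => (hout _ (auxQ_castAdd _ b)).2) hs1 hs2
    exact ⟨c.1, c.2.1⟩
  refine SymbData.det_monskyOddS_eq_one_of_staged_constancy (agreeOffAux_dataK base [c₁, c₂] (fun _ _ => false) pat)
    (δ₁ := 2) (δ₂ := 0) (by omega) (by omega) (by omega) ?_ ?_ ?_
  · -- stage one, direction w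
    intro z hout hs1 hs2 i j hi hj
    simp only [h20, h21, if_false]
    obtain ⟨he, -⟩ := CORE z hout hs1 hs2
    obtain ⟨i', rfl⟩ := auxIdx i hi
    obtain ⟨j', rfl⟩ := auxIdx j hj
    have hw : z (Sum.inl (Fin.natAdd (k + 1) (⟨0, by simp⟩ : Fin [c₁, c₂].length))) +
        z (Sum.inr (Fin.natAdd (k + 1) (⟨0, by simp⟩ : Fin [c₁, c₂].length))) =
        z (Sum.inl (Fin.natAdd (k + 1) (⟨1, by simp⟩ : Fin [c₁, c₂].length))) +
        z (Sum.inr (Fin.natAdd (k + 1) (⟨1, by simp⟩ : Fin [c₁, c₂].length))) :=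
      (zmod_two_eq_iff_add_eq_zero _ _).mpr he
    rcases fin_two_cells_cases c₁ c₂ i' with rfl | rfl <;> rcases fin_two_cells_cases c₁ c₂ j' with rfl | rfl
    · rfl
    · exact hw
    · exact hw.symm
    · rfl
  · -- stage two, direction u
    intro z hout hs1 hs2 _ i j hi hj
    simp only [if_true]
    obtain ⟨-, hu⟩ := CORE z hout hs1 hs2
    obtain ⟨i', rfl⟩ := auxIdx i hi
    obtain ⟨j', rfl⟩ := auxIdx j hj
    rcases fin_two_cells_cases c₁ c₂ i' with rfl | rfl <;> rcases fin_two_cells_cases c₁ c₂ j' with rfl | rfl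
    · rfl
    · exact hu
    · exact hu.symm
    · rfl
  · -- stage three
    intro z hconst hz
    exact twoPrime_S3 base c₁ c₂ hm1 hm2 hd hσ hodd u1 w1 hE1 hE2 hker hdes z hconst hz

/-- The two-prime recipe passes the Heegner check. -/
theorem heegnerK_twoPrime (hm1 : negNegOne c₁.1 = true) (hm2 : negNegOne c₂.1 = false) (hd : negTwo c₁.1 = negTwo c₂.1)
    (hσ : ∀ b : Fin (k + 1), c₁.2.testBit b.val = xor (negNegOne (base.cls b)) (c₂.2.testBit b.val)) :
    heegnerK base [c₁, c₂] = true := by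
  unfold heegnerK
  simp only [List.length_cons, List.length_nil, Nat.zero_add, Nat.reduceAdd, Nat.ofNat_pos, decide_true, List.map_cons,
    List.map_nil, List.prod_cons, List.prod_nil, mul_one, Bool.true_and, Bool.and_eq_true, beq_iff_eq, List.all_eq_true,
    List.mem_finRange, true_implies]
  constructor
  · -- product of the classes ≡ 7 (mod 8)
    rcases c₁ with ⟨a₁, s₁⟩
    rcases c₂ with ⟨a₂, s₂⟩
    simp only at hm1 hm2 hd ⊢
    revert hm1 hm2 hd
    fin_cases a₁ <;> fin_cases a₂ <;> decide
  · intro b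
    rw [xorFold_cons, xorFold_cons, xorFold_nil, hσ b]
    cases negNegOne (base.cls b) <;> cases c₂.2.testBit b.val <;> rfl

/-- ★★ **Packaged form**: the two-prime recipe passes the Heegner check and wins for every mutual pattern. -/
theorem twoPrime_recipe (hm1 : negNegOne c₁.1 = true) (hm2 : negNegOne c₂.1 = false) (hd : negTwo c₁.1 = negTwo c₂.1)
    (hσ : ∀ b : Fin (k + 1), c₁.2.testBit b.val = xor (negNegOne (base.cls b)) (c₂.2.testBit b.val))
    (hodd : (∑ b : Fin (k + 1), bz (c₂.2.testBit b.val)) = 1)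
    (u1 w1 : Fin (k + 1) → ZMod 2)
    (hE1 : ∀ i, (∑ j, bz (base.neg i j) * (u1 j + u1 i)) + bz (negNegOne (base.cls i)) * u1 i + bz (negTwo (base.cls i)) * w1 i = 0)
    (hE2 : ∀ i, bz (negNegOne (base.cls i)) * u1 i + ∑ j, bz (base.neg i j) * (w1 j + w1 i) = 0)
    (hker : ∀ x y : Fin (k + 1) → ZMod 2,
      (∀ i, (∑ j, bz (base.neg i j) * (x j + x i)) + bz (negNegOne (base.cls i)) * x i + bz (negTwo (base.cls i)) * y i = 0) →
      (∀ i, bz (negNegOne (base.cls i)) * x i + ∑ j, bz (base.neg i j) * (y j + y i) = 0) →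
      (x = 0 ∧ y = 0) ∨ (x = u1 ∧ y = w1))
    (hdes : bz (negTwo c₂.1) * (∑ b : Fin (k + 1), bz (c₂.2.testBit b.val) * w1 b) +
      (∑ b : Fin (k + 1), bz (c₂.2.testBit b.val) * u1 b) = 1) :
    heegnerK base [c₁, c₂] = true ∧ ∀ pat : ℕ → ℕ → Bool, (dataK base [c₁, c₂] pat).monskyOddS.det = 1 :=
  ⟨heegnerK_twoPrime base c₁ c₂ hm1 hm2 hd hσ,
    fun pat => det_dataK_twoPrime_eq_one base c₁ c₂ hm1 hm2 hd hσ hodd u1 w1 hE1 hE2 hker hdes pat⟩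


/-! ### Explicit cells from one base index in the support of the kernel pair -/

/-- The symbol mask `m + e_(b₀)` as a bitmask. -/
theorem testBit_ofBits_ofFn (f : Fin (k + 1) → Bool) (b : Fin (k + 1)) :
    (ofBits (List.ofFn f)).testBit b.val = f b := by
  rw [testBit_ofBits, List.getD_eq_getElem?_getD, List.getElem?_ofFn]
  simp [b.isLt]

/-- `∑_b bz [(2^b₀) has bit b] · g b = g b₀`. -/
theorem sum_bz_testBit_two_pow_mul (b₀ : Fin (k + 1)) (g : Fin (k + 1) → ZMod 2) :
    (∑ b : Fin (k + 1), bz ((2 ^ b₀.val).testBit b.val) * g b) = g b₀ := by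
  have : ∀ b : Fin (k + 1), bz ((2 ^ b₀.val).testBit b.val) * g b = if b₀ = b then g b else 0 := by
    intro b
    rw [Nat.testBit_two_pow]
    by_cases h : b₀ = b
    · subst h; simp [bz]
    · have : b₀.val ≠ b.val := fun e => h (Fin.ext e)
      simp [h, this, bz]
  rw [Finset.sum_congr rfl fun b _ => this b, Finset.sum_ite_eq]; simp

/-- ★★ **Existence, explicit form.** If `(u¹, w¹)` spans the virtual kernel of the base (`s* = 2`) and `b₀` is a base index with
`u¹_(b₀) = 1`, the cells `c₁ = (class 7, bits m + e_(b₀))`, `c₂ = (class 1, bits e_(b₀))` — i.e. `q₁ ≡ 7 (8)` with `(q₁/P_b) = −1` iff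
`[P_b ≡ 3 (4)] ≠ [b = b₀]`, and `q₂ ≡ 1 (8)` a non-residue at `P_(b₀)` only — form a pattern-free Heegner recipe; if instead `u¹_(b₀) = 0` and
`w¹_(b₀) = 1`, the classes `3` and `5` do. -/
theorem twoPrime_recipe_of_index (u1 w1 : Fin (k + 1) → ZMod 2)
    (hE1 : ∀ i, (∑ j, bz (base.neg i j) * (u1 j + u1 i)) + bz (negNegOne (base.cls i)) * u1 i + bz (negTwo (base.cls i)) * w1 i = 0)
    (hE2 : ∀ i, bz (negNegOne (base.cls i)) * u1 i + ∑ j, bz (base.neg i j) * (w1 j + w1 i) = 0)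
    (hker : ∀ x y : Fin (k + 1) → ZMod 2,
      (∀ i, (∑ j, bz (base.neg i j) * (x j + x i)) + bz (negNegOne (base.cls i)) * x i + bz (negTwo (base.cls i)) * y i = 0) →
      (∀ i, bz (negNegOne (base.cls i)) * x i + ∑ j, bz (base.neg i j) * (y j + y i) = 0) →
      (x = 0 ∧ y = 0) ∨ (x = u1 ∧ y = w1))
    (b₀ : Fin (k + 1)) (ε : Bool) (hb : (if ε then w1 b₀ else 0) + u1 b₀ = 1) :
    heegnerK base [((if ε then 1 else 3 : Fin 4), ofBits (List.ofFn fun b : Fin (k + 1) => xor (negNegOne (base.cls b)) (decide (b₀ = b)))),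
        ((if ε then 2 else 0 : Fin 4), 2 ^ b₀.val)] = true ∧
      ∀ pat : ℕ → ℕ → Bool,
        (dataK base [((if ε then 1 else 3 : Fin 4), ofBits (List.ofFn fun b : Fin (k + 1) => xor (negNegOne (base.cls b)) (decide (b₀ = b)))),
          ((if ε then 2 else 0 : Fin 4), 2 ^ b₀.val)] pat).monskyOddS.det = 1 := by
  have hσ : ∀ b : Fin (k + 1), (ofBits (List.ofFn fun b : Fin (k + 1) => xor (negNegOne (base.cls b)) (decide (b₀ = b)))).testBit b.val =
      xor (negNegOne (base.cls b)) ((2 ^ b₀.val).testBit b.val) := by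
    intro b
    rw [testBit_ofBits_ofFn, Nat.testBit_two_pow]
    by_cases h : b₀ = b
    · subst h; simp
    · have : b₀.val ≠ b.val := fun e => h (Fin.ext e)
      simp [h, this]
  have hodd : (∑ b : Fin (k + 1), bz ((2 ^ b₀.val).testBit b.val)) = 1 := by
    have := sum_bz_testBit_two_pow_mul b₀ (fun _ => (1 : ZMod 2))
    simpa using this
  have hdes : bz (negTwo (if ε then 2 else 0 : Fin 4)) * (∑ b : Fin (k + 1), bz ((2 ^ b₀.val).testBit b.val) * w1 b) +
      (∑ b : Fin (k + 1), bz ((2 ^ b₀.val).testBit b.val) * u1 b) = 1 := by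
    rw [sum_bz_testBit_two_pow_mul, sum_bz_testBit_two_pow_mul]
    cases ε
    · simp [negTwo, bz] at hb ⊢; exact hb
    · simp [negTwo, bz] at hb ⊢; exact hb
  refine twoPrime_recipe base _ _ ?_ ?_ ?_ hσ hodd u1 w1 hE1 hE2 hker hdes
  · cases ε
    · show negNegOne 3 = true; decide
    · show negNegOne 1 = true; decide
  · cases ε
    · show negNegOne 0 = false; decide
    · show negNegOne 2 = false; decide
  · cases ε
    · show negTwo 3 = negTwo 0; decide
    · show negTwo 1 = negTwo 2; decide

/-- ★★ **Existence (s* = 2).** If the virtual kernel of the base is the line spanned by a non-zero pair `(u¹, w¹)`, a pattern-free two-prime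
Heegner recipe exists. -/
theorem exists_twoPrime_recipe (u1 w1 : Fin (k + 1) → ZMod 2) (hne : ¬ (u1 = 0 ∧ w1 = 0))
    (hE1 : ∀ i, (∑ j, bz (base.neg i j) * (u1 j + u1 i)) + bz (negNegOne (base.cls i)) * u1 i + bz (negTwo (base.cls i)) * w1 i = 0)
    (hE2 : ∀ i, bz (negNegOne (base.cls i)) * u1 i + ∑ j, bz (base.neg i j) * (w1 j + w1 i) = 0)
    (hker : ∀ x y : Fin (k + 1) → ZMod 2,
      (∀ i, (∑ j, bz (base.neg i j) * (x j + x i)) + bz (negNegOne (base.cls i)) * x i + bz (negTwo (base.cls i)) * y i = 0) →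
      (∀ i, bz (negNegOne (base.cls i)) * x i + ∑ j, bz (base.neg i j) * (y j + y i) = 0) →
      (x = 0 ∧ y = 0) ∨ (x = u1 ∧ y = w1)) :
    ∃ c₁ c₂ : AuxCell, heegnerK base [c₁, c₂] = true ∧ ∀ pat : ℕ → ℕ → Bool, (dataK base [c₁, c₂] pat).monskyOddS.det = 1 := by
  by_cases hu : ∃ b₀, u1 b₀ = 1
  · obtain ⟨b₀, hb⟩ := hu
    exact ⟨_, _, twoPrime_recipe_of_index base u1 w1 hE1 hE2 hker b₀ false (by simpa using hb)⟩
  · push Not at hu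
    have hu0 : u1 = 0 := by
      funext b
      rcases zmod_two_eq_zero_or_eq_one (u1 b) with h | h
      · exact h
      · exact absurd h (hu b)
    have hw : ∃ b₀, w1 b₀ = 1 := by
      by_contra hw
      push Not at hw
      apply hne
      refine ⟨hu0, funext fun b => ?_⟩
      rcases zmod_two_eq_zero_or_eq_one (w1 b) with h | h
      · exact h
      · exact absurd h (hw b)
    obtain ⟨b₀, hb⟩ := hw
    refine ⟨_, _, twoPrime_recipe_of_index base u1 w1 hE1 hE2 hker b₀ true ?_⟩
    simp [hb, hu0]

end TwoPrimeMain

end Summit.BirchSwinnertonDyer.BirchSwinnertonDyer.Theorems.SymbolicMonsky
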